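import Summits.QuantumFields.YangMills.Theorems.UnitScaleTiltProp7CurrentPairingPointwise
import Summits.QuantumFields.YangMills.Theorems.UnitScaleTiltProp7BlockDistanceWeights
import Summits.QuantumFields.YangMills.Theorems.UnitScaleTiltProp7HessOnPrintSlice
import HarnessLib

/-!
# Route `UnitScaleTilt`, crux K1 «MinimiserStabilityRegPr» (stmt-QuantumFields-19200), EX rows `h133`∕`norm_Hπ` — NORM_G ROAD brick N6, FILE D1: **THE LOCAL MULTIPLIERS IN DECAY FORM**
# ((C-val)∕(C-div) of FILE A against Agmon weights: the (3.117) bracket against a SITE spike, the LOCAL covariant-divergence row of `Δ^η`, adjacent-block slack `e^{4δ}`)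

Cell `ym3-torus` (HUMAN RULING D-0037; rung R3 = SU(2) YM₃ on T³ — NOT d = 4, NOT infinite volume, NOT a mass gap, NOT Clay).  Fleet lead ∕ chair seat `ym-ust-19200-p1` (gen 27),
CHAIR WORD №30.  THEOREMS ONLY (0 `def`, 0 `sorry`); `--supports stmt-QuantumFields-19200 --as helper`; count-neutral.  Consumed by FILE D2 `…Prop7GreenPiBlockDecayOfLetters` (the
Agmon-weighted `(sup, sup∘D*)` bootstrap for `G_π`).

WHAT IS PROVED (ns `…Theorems.Prop7GreenPiBlockDecayLocal`; member `F n K`, weight `c₀ > 0`, rate `0 ≤ δ`, blocks `B := iterBlockOf (K−n)`, `dc` = coarse `ℓ¹` torus distance).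
* `tdist_iterBlockOf_src_tgt_le` (`dc(B b₋, B b₊) ≤ 4`, ✓`tdist_iterBlockOf_le`), `exp_neg_tdist_tgt_le`∕`exp_neg_tdist_src_le` (`e^{−δdc(B b₊,z)} ≤ e^{4δ}e^{−δdc(B b₋,z)}` and conversely).
* `norm_bondPair_bracket_le_sum` (the (3.117) bracket termwise: `≤ 4jΣ_yΣ_μ(‖λ(y)‖‖F_μ(y)‖ + ‖F_μ(y)‖‖λ(y+e_μ)‖)`), ★ `norm_bondPair_bracket_siteSingle_le` (against a SITE spike `δ_xE`:
  `≤ 4j‖E‖Σ_μ(‖F⟨x,μ⟩‖ + ‖F⟨x−e_μ,μ⟩‖)`).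
* ★★ `norm_symm_DstarL2_DeltaEta_toL2_apply_le_local` — LOCAL (C-div) on `RegPr α`: `‖(toL2S⁻¹(D*Δ^η(toL2 F)))(x)‖ ≤ 2α·Σ_μ(‖F⟨x,μ⟩‖ + ‖F⟨x−e_μ,μ⟩‖)` (the global edition is FILE A's
  ✓`norm_symm_DstarL2_DeltaEta_toL2_apply_le`, `≤ 12αs`).
* ★★ `DeltaEta_DL2_decay` (decaying `λ` ⟹ `‖(Δ^ηDλ)(b)‖ ≤ 2α(1+e^{4δ})·m·e^{−δdc(B b₋,z)}`), ★★ `DstarL2_DeltaEta_decay` (decaying `F` ⟹ `‖(D*Δ^ηF)(x)‖ ≤ 6α(1+e^{4δ})·m·e^{−δdc(B x,z)}`).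
HONEST SCOPE.  Pointwise algebra of the printed (3.117) bracket + the Riesz step of FILE A; nothing of `h133`, `norm_G`, the 8 EX rows, `hThm2S`, EX or the crux is proved; nothing continuum ∕ Clay.

References: T. Bałaban, CMP **99** (1985) 389–434 [Balaban1985BackgroundPropagators] ((3.117) p.419, (3.131) p.422, (3.8) p.392); CMP **98** (1985) 17–51 [Balaban1985Averaging] ((2) p.17);
CMP **102** (1985) 277–309 [Balaban1985Variational] ((28) p.282).
-/

set_option autoImplicit false

noncomputable section

open scoped Matrix.Norms.L2Operator BigOperators InnerProductSpace ComplexConjugate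
open Complex (I)

namespace Summit.QuantumFields.YangMills.Theorems.Prop7GreenPiBlockDecayLocal

open Literature.MathematicalPhysics.QuantumFieldTheory.Balaban1983to89
open Literature.MathematicalPhysics.QuantumFieldTheory.Balaban1983to89.T3ContinuumYM3Torus
open T3PrintedRegularMinimiser (RegPr)
open T3SectALandauChart (formComp bgUnits eta eta_pos)
open B5Eq118OneStroke (iterBlockOf)
open B9TorusCalculus (torusT)
open B9Eq39Adjoint (R bondPair J)
open B9Eq310Hermitian (norm_R_le)
open B9Eq3131Pointwise (norm_I_ad_le)
open Beta.BackgroundVertices (ad ad_apply)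
open B9Eq311L2Pairing (WL2)
open B11Eq103H1Complex (SiteL2K BondL2K)
open Summit.QuantumFields.YangMills.Theorems.Prop7SectET3Transport (periodsT3)
open Summit.QuantumFields.YangMills.Theorems.Prop7SectET3HilbertLetters (W₂ toL2 toL2S QL2 DL2 DstarL2 covLapSite adjoint_DL2)
open Summit.QuantumFields.YangMills.Theorems.Prop7SectET3GaugeProjector (NS RS RS_RS)
open Summit.QuantumFields.YangMills.Theorems.Prop7SectET3WilsonHessian (DeltaEta DeltaEtaSlot DeltaEta_isSymmetric)
open Summit.QuantumFields.YangMills.Theorems.Prop7SectET3CurvedPropagators (Qk laplaceA PosOnto GT)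
open Summit.QuantumFields.YangMills.Theorems.Prop7SectET3DeltaPiPInv (GprimeP gaugeCorrP DeltaPiSlotP gaugeCorrP_apply)
open Summit.QuantumFields.YangMills.Theorems.Prop7SecondOrderDict (norm_bgUnits_le_one)
open Summit.QuantumFields.YangMills.Theorems.Prop7DeltaPiDefectPairing (inner_DL2_toL2S_DeltaEta_toL2 norm_J_one_le_of_regPr)
open Summit.QuantumFields.YangMills.Theorems.Prop7CurrentPairingPointwise (norm_apply_le_of_norm_inner_siteSingle_le norm_symm_DeltaEta_DL2_toL2S_apply_le)
open Summit.QuantumFields.YangMills.Theorems.Prop7BlockDistanceWeights (tdist_iterBlockOf_le tdist_src_tgt_le_one tdist_coarse_triangle tdist_coarse_comm sum_exp_neg_mul_tdist_coarse_le)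

variable {F : T3Family} {n K : ℕ} {h : n ≤ K} {c₀ cB a : ℝ}

/-! ## §1 Geometry of adjacent blocks and the local multipliers in decay form -/

section Geometry

/-- The blocks of the two ends of a fine bond are at coarse `ℓ¹` distance `≤ 4` (✓`tdist_iterBlockOf_le`: `≤ 1∕Lᵏ + 3`). [cite: Balaban1985Averaging, (2) p.17] -/
theorem tdist_iterBlockOf_src_tgt_le (b : PBond (F.P K) 0) :
    (Site.tdist (iterBlockOf (K - n) b.src) (iterBlockOf (K - n) b.tgt) : ℝ) ≤ 4 := by
  have hk : K - n ≤ (F.P K).m + (F.P K).K := by show K - n ≤ F.m + K; omega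
  have hcon := tdist_iterBlockOf_le hk b.src b.tgt
  have hd : (F.P K).d = 3 := rfl
  have h1 : Site.tdist b.src b.tgt / (F.P K).L ^ (K - n) ≤ 1 := (Nat.div_le_self _ _).trans (tdist_src_tgt_le_one b)
  have h2 : Site.tdist (iterBlockOf (K - n) b.src) (iterBlockOf (K - n) b.tgt) ≤ 4 := by rw [hd] at hcon; omega
  exact_mod_cast h2

/-- `e^{−δ·dc(B b₊, z)} ≤ e^{4δ}·e^{−δ·dc(B b₋, z)}` for `0 ≤ δ`. [cite: Balaban1985Averaging, (2) p.17] -/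
theorem exp_neg_tdist_tgt_le {δ : ℝ} (hδ : 0 ≤ δ) (b : PBond (F.P K) 0) (z : Site (F.P K) (K - n)) :
    Real.exp (-(δ * (Site.tdist (iterBlockOf (K - n) b.tgt) z : ℝ))) ≤ Real.exp (4 * δ) * Real.exp (-(δ * (Site.tdist (iterBlockOf (K - n) b.src) z : ℝ))) := by
  rw [← Real.exp_add, Real.exp_le_exp]
  have ht := tdist_coarse_triangle F (iterBlockOf (K - n) b.src) (iterBlockOf (K - n) b.tgt) z
  have h4 := tdist_iterBlockOf_src_tgt_le (n := n) b
  nlinarith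

/-- `e^{−δ·dc(B b₋, z)} ≤ e^{4δ}·e^{−δ·dc(B b₊, z)}` for `0 ≤ δ`. [cite: Balaban1985Averaging, (2) p.17] -/
theorem exp_neg_tdist_src_le {δ : ℝ} (hδ : 0 ≤ δ) (b : PBond (F.P K) 0) (z : Site (F.P K) (K - n)) :
    Real.exp (-(δ * (Site.tdist (iterBlockOf (K - n) b.src) z : ℝ))) ≤ Real.exp (4 * δ) * Real.exp (-(δ * (Site.tdist (iterBlockOf (K - n) b.tgt) z : ℝ))) := by
  rw [← Real.exp_add, Real.exp_le_exp]
  have ht := tdist_coarse_triangle F (iterBlockOf (K - n) b.tgt) (iterBlockOf (K - n) b.src) z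
  have h4 := tdist_iterBlockOf_src_tgt_le (n := n) b
  rw [tdist_coarse_comm] at h4
  nlinarith

end Geometry

section Local

variable [Fact (0 < c₀)]

/-- **THE (3.117) BRACKET, TERMWISE**: for every `λ`, `F`, and `‖J(μ,y)‖ ≤ j`,
`‖⟨i[λ(y),F_μ(y)] − i[F_μ(y),R_{(y,μ)}λ(y+e_μ)], J⟩₁‖ ≤ 4·j·Σ_yΣ_μ(‖λ(y)‖‖F_μ(y)‖ + ‖F_μ(y)‖‖λ(y+e_μ)‖)`. [cite: Balaban1985BackgroundPropagators, (3.117) p.419, (3.131) p.422] -/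
theorem norm_bondPair_bracket_le_sum (U₀ : GaugeField (F.P K) 0 (Matrix.specialUnitaryGroup (Fin 2) ℂ)) (lam : Site (F.P K) 0 → Matrix (Fin 2) (Fin 2) ℂ)
    (Fμ Jf : Fin (F.P K).d → Site (F.P K) 0 → Matrix (Fin 2) (Fin 2) ℂ) {j : ℝ} (hJ : ∀ μ y, ‖Jf μ y‖ ≤ j) :
    ‖bondPair 1 3 (Matrix.traceLinearMap (Fin 2) ℂ ℂ)
        (fun μ y => I • ad (lam y) (Fμ μ y) - I • ad (Fμ μ y) (R (bgUnits F K U₀ ⟨y, μ⟩) (lam (torusT (F.P K) 0 μ y)))) Jf‖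
      ≤ 4 * j * ∑ y : Site (F.P K) 0, ∑ μ : Fin (F.P K).d, (‖lam y‖ * ‖Fμ μ y‖ + ‖Fμ μ y‖ * ‖lam (torusT (F.P K) 0 μ y)‖) := by
  rw [bondPair, Complex.ofReal_one, one_pow, one_mul]
  -- pointwise bound of each term
  have hpt : ∀ (μ : Fin (F.P K).d) (y : Site (F.P K) 0),
      ‖Matrix.traceLinearMap (Fin 2) ℂ ℂ ((I • ad (lam y) (Fμ μ y) - I • ad (Fμ μ y) (R (bgUnits F K U₀ ⟨y, μ⟩) (lam (torusT (F.P K) 0 μ y)))) * Jf μ y)‖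
        ≤ 4 * j * (‖lam y‖ * ‖Fμ μ y‖ + ‖Fμ μ y‖ * ‖lam (torusT (F.P K) 0 μ y)‖) := by
    intro μ y
    rw [Matrix.traceLinearMap_apply]
    refine (FlatPlaqDeriv.norm_trace_mul_le _ _).trans ?_
    have hR : ‖R (bgUnits F K U₀ ⟨y, μ⟩) (lam (torusT (F.P K) 0 μ y))‖ ≤ ‖lam (torusT (F.P K) 0 μ y)‖ :=
      norm_R_le (norm_bgUnits_le_one F K U₀ ⟨y, μ⟩).1 (norm_bgUnits_le_one F K U₀ ⟨y, μ⟩).2 _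
    have h1 : ‖I • ad (lam y) (Fμ μ y)‖ ≤ 2 * ‖lam y‖ * ‖Fμ μ y‖ := norm_I_ad_le _ _
    have h2 : ‖I • ad (Fμ μ y) (R (bgUnits F K U₀ ⟨y, μ⟩) (lam (torusT (F.P K) 0 μ y)))‖ ≤ 2 * ‖Fμ μ y‖ * ‖lam (torusT (F.P K) 0 μ y)‖ :=
      (norm_I_ad_le _ _).trans (by nlinarith [hR, norm_nonneg (Fμ μ y), norm_nonneg (R (bgUnits F K U₀ ⟨y, μ⟩) (lam (torusT (F.P K) 0 μ y)))])
    have hbr : ‖I • ad (lam y) (Fμ μ y) - I • ad (Fμ μ y) (R (bgUnits F K U₀ ⟨y, μ⟩) (lam (torusT (F.P K) 0 μ y)))‖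
        ≤ 2 * (‖lam y‖ * ‖Fμ μ y‖ + ‖Fμ μ y‖ * ‖lam (torusT (F.P K) 0 μ y)‖) := (norm_sub_le _ _).trans (by linarith [h1, h2])
    have hJy := hJ μ y
    have hnn : 0 ≤ ‖lam y‖ * ‖Fμ μ y‖ + ‖Fμ μ y‖ * ‖lam (torusT (F.P K) 0 μ y)‖ := by positivity
    calc 2 * ‖I • ad (lam y) (Fμ μ y) - I • ad (Fμ μ y) (R (bgUnits F K U₀ ⟨y, μ⟩) (lam (torusT (F.P K) 0 μ y)))‖ * ‖Jf μ y‖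
        ≤ 2 * (2 * (‖lam y‖ * ‖Fμ μ y‖ + ‖Fμ μ y‖ * ‖lam (torusT (F.P K) 0 μ y)‖)) * j :=
          mul_le_mul (mul_le_mul_of_nonneg_left hbr (by norm_num)) hJy (norm_nonneg _) (by linarith)
      _ = 4 * j * (‖lam y‖ * ‖Fμ μ y‖ + ‖Fμ μ y‖ * ‖lam (torusT (F.P K) 0 μ y)‖) := by ring
  calc ‖∑ y : Site (F.P K) 0, ∑ μ : Fin (F.P K).d,
          Matrix.traceLinearMap (Fin 2) ℂ ℂ ((I • ad (lam y) (Fμ μ y) - I • ad (Fμ μ y) (R (bgUnits F K U₀ ⟨y, μ⟩) (lam (torusT (F.P K) 0 μ y)))) * Jf μ y)‖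
      ≤ ∑ y : Site (F.P K) 0, ∑ μ : Fin (F.P K).d, 4 * j * (‖lam y‖ * ‖Fμ μ y‖ + ‖Fμ μ y‖ * ‖lam (torusT (F.P K) 0 μ y)‖) :=
        (norm_sum_le _ _).trans (Finset.sum_le_sum fun y _ => (norm_sum_le _ _).trans (Finset.sum_le_sum fun μ _ => hpt μ y))
    _ = 4 * j * ∑ y : Site (F.P K) 0, ∑ μ : Fin (F.P K).d, (‖lam y‖ * ‖Fμ μ y‖ + ‖Fμ μ y‖ * ‖lam (torusT (F.P K) 0 μ y)‖) := by
        rw [Finset.mul_sum]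
        exact Finset.sum_congr rfl fun y _ => by rw [Finset.mul_sum]

/-- ★ **THE (3.117) BRACKET AGAINST A SITE SPIKE `λ := δ_xE`**: only the `2d` bonds touching `x` contribute —
`‖⟨i[λ(b₋),F(b)] − i[F(b),R_bλ(b₊)], J⟩₁‖ ≤ 4·j·‖E‖·Σ_μ(‖F⟨x,μ⟩‖ + ‖F⟨x − e_μ, μ⟩‖)` for `‖J(b)‖ ≤ j`. [cite: Balaban1985BackgroundPropagators, (3.117) p.419, (3.131) p.422] -/
theorem norm_bondPair_bracket_siteSingle_le (U₀ : GaugeField (F.P K) 0 (Matrix.specialUnitaryGroup (Fin 2) ℂ)) (x : Site (F.P K) 0) (E : Matrix (Fin 2) (Fin 2) ℂ)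
    (Fμ Jf : Fin (F.P K).d → Site (F.P K) 0 → Matrix (Fin 2) (Fin 2) ℂ) {j : ℝ} (hJ : ∀ μ y, ‖Jf μ y‖ ≤ j) :
    ‖bondPair 1 3 (Matrix.traceLinearMap (Fin 2) ℂ ℂ)
        (fun μ y => I • ad ((Pi.single x E : Site (F.P K) 0 → Matrix (Fin 2) (Fin 2) ℂ) y) (Fμ μ y)
          - I • ad (Fμ μ y) (R (bgUnits F K U₀ ⟨y, μ⟩) ((Pi.single x E : Site (F.P K) 0 → Matrix (Fin 2) (Fin 2) ℂ) (torusT (F.P K) 0 μ y)))) Jf‖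
      ≤ 4 * j * ‖E‖ * ∑ μ : Fin (F.P K).d, (‖Fμ μ x‖ + ‖Fμ μ ((torusT (F.P K) 0 μ).symm x)‖) := by
  classical
  refine (norm_bondPair_bracket_le_sum U₀ (Pi.single x E) Fμ Jf hJ).trans (le_of_eq ?_)
  -- the spike sums
  have hs1 : ∀ μ : Fin (F.P K).d, ∑ y : Site (F.P K) 0, ‖(Pi.single x E : Site (F.P K) 0 → Matrix (Fin 2) (Fin 2) ℂ) y‖ * ‖Fμ μ y‖ = ‖E‖ * ‖Fμ μ x‖ := by
    intro μ
    rw [Finset.sum_eq_single x]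
    · rw [Pi.single_eq_same]
    · intro y _ hy; rw [Pi.single_eq_of_ne hy, norm_zero, zero_mul]
    · intro hx; exact absurd (Finset.mem_univ x) hx
  have hs2 : ∀ μ : Fin (F.P K).d, ∑ y : Site (F.P K) 0, ‖Fμ μ y‖ * ‖(Pi.single x E : Site (F.P K) 0 → Matrix (Fin 2) (Fin 2) ℂ) (torusT (F.P K) 0 μ y)‖
      = ‖Fμ μ ((torusT (F.P K) 0 μ).symm x)‖ * ‖E‖ := by
    intro μ
    rw [Finset.sum_eq_single ((torusT (F.P K) 0 μ).symm x)]
    · rw [Equiv.apply_symm_apply, Pi.single_eq_same]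
    · intro y _ hy
      have hne : torusT (F.P K) 0 μ y ≠ x := fun e => hy (by rw [← e, Equiv.symm_apply_apply])
      rw [Pi.single_eq_of_ne hne, norm_zero, mul_zero]
    · intro hx; exact absurd (Finset.mem_univ _) hx
  rw [Finset.sum_comm, Finset.mul_sum, Finset.mul_sum]
  refine Finset.sum_congr rfl fun μ _ => ?_
  rw [Finset.sum_add_distrib, hs1 μ, hs2 μ]
  ring

/-- ★★ **LOCAL (C-div)**: on `RegPr F n K α U₀`, for every vector field `F` and every site `x`,
`‖(toL2S⁻¹(D*_{U₀}(Δ^η_{U₀}(toL2 F))))(x)‖ ≤ 2·α·Σ_μ(‖F⟨x,μ⟩‖ + ‖F⟨x − e_μ, μ⟩‖)` — only the six bonds touching `x` enter (the global edition is ✓`norm_symm_DstarL2_DeltaEta_toL2_apply_le`).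
[cite: Balaban1985BackgroundPropagators, (3.117) p.419, (3.8) p.392; Balaban1985Variational, (28) p.282] -/
theorem norm_symm_DstarL2_DeltaEta_toL2_apply_le_local {α : ℝ} (U₀ : GaugeField (F.P K) 0 (Matrix.specialUnitaryGroup (Fin 2) ℂ)) (hreg : RegPr F n K α U₀)
    (Fv : PBond (F.P K) 0 → Matrix (Fin 2) (Fin 2) ℂ) (x : Site (F.P K) 0) :
    ‖(toL2S F K c₀).symm (DstarL2 F n K c₀ U₀ (DeltaEta F n K c₀ U₀ (toL2 F K c₀ Fv))) x‖
      ≤ 2 * α * ∑ μ : Fin (F.P K).d, (‖Fv ⟨x, μ⟩‖ + ‖Fv ⟨(torusT (F.P K) 0 μ).symm x, μ⟩‖) := by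
  have hc₀ : 0 < c₀ := Fact.out
  have hη : 0 < eta F n K := eta_pos F n K
  have hJ := norm_J_one_le_of_regPr U₀ hreg
  have hα : 0 ≤ α := by
    have h0 : 0 * eta F n K ^ 3 ≤ α * eta F n K ^ 3 := by rw [zero_mul]; exact (norm_nonneg _).trans (hJ 0 x)
    exact le_of_mul_le_mul_right h0 (pow_pos hη 3)
  have hS : 0 ≤ ∑ μ : Fin (F.P K).d, (‖Fv ⟨x, μ⟩‖ + ‖Fv ⟨(torusT (F.P K) 0 μ).symm x, μ⟩‖) :=
    Finset.sum_nonneg fun μ _ => add_nonneg (norm_nonneg _) (norm_nonneg _)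
  have h2αS : 0 ≤ 2 * α * ∑ μ : Fin (F.P K).d, (‖Fv ⟨x, μ⟩‖ + ‖Fv ⟨(torusT (F.P K) 0 μ).symm x, μ⟩‖) := mul_nonneg (mul_nonneg zero_le_two hα) hS
  set W : Site (F.P K) 0 → Matrix (Fin 2) (Fin 2) ℂ := (toL2S F K c₀).symm (DstarL2 F n K c₀ U₀ (DeltaEta F n K c₀ U₀ (toL2 F K c₀ Fv))) with hW
  have hWeq : toL2S F K c₀ W = DstarL2 F n K c₀ U₀ (DeltaEta F n K c₀ U₀ (toL2 F K c₀ Fv)) := LinearEquiv.apply_symm_apply _ _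
  refine norm_apply_le_of_norm_inner_siteSingle_le (c₀ := c₀) W x h2αS ?_
  -- `⟪D*Δ^ηF̃, μ̃⟫ = ⟪Δ^ηF̃, Dμ̃⟫ = conj ⟪Dμ̃, Δ^ηF̃⟫`, then the pairing identity
  rw [hWeq, Prop7HessOnPrintSlice.inner_DstarL2_left, ← inner_conj_symm, RCLike.norm_conj, inner_DL2_toL2S_DeltaEta_toL2 U₀ (Pi.single x (W x)) Fv]
  -- `(δ_x(W x))ᴴ = δ_x (W x)ᴴ`
  have hstar : star (Pi.single x (W x) : Site (F.P K) 0 → Matrix (Fin 2) (Fin 2) ℂ) = Pi.single x (star (W x)) := by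
    funext y
    rw [Pi.star_apply]
    by_cases hy : y = x
    · subst hy; rw [Pi.single_eq_same, Pi.single_eq_same]
    · rw [Pi.single_eq_of_ne hy, Pi.single_eq_of_ne hy, star_zero]
  have hbr := norm_bondPair_bracket_siteSingle_le U₀ x (star (W x)) (formComp Fv)
    (J (torusT (F.P K) 0) (fun μ x => bgUnits F K U₀ ⟨x, μ⟩) 1) (fun μ y => hJ μ y)
  rw [← hstar, Matrix.star_eq_conjTranspose, Matrix.l2_opNorm_conjTranspose] at hbr
  have hcoef : ‖(c₀ : ℂ) * ((((eta F n K)⁻¹ ^ 3 : ℝ) : ℂ)) * (2 : ℂ)⁻¹‖ = c₀ * (eta F n K)⁻¹ ^ 3 * 2⁻¹ := by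
    rw [norm_mul, norm_mul, Complex.norm_real, Complex.norm_real, Real.norm_of_nonneg hc₀.le, Real.norm_of_nonneg (pow_nonneg (inv_nonneg.2 hη.le) 3),
      norm_inv, RCLike.norm_two]
  have hη3 : (eta F n K)⁻¹ ^ 3 * eta F n K ^ 3 = 1 := by rw [inv_pow, inv_mul_cancel₀ (pow_ne_zero 3 hη.ne')]
  have hcoef0 : 0 ≤ c₀ * (eta F n K)⁻¹ ^ 3 * 2⁻¹ := mul_nonneg (mul_nonneg hc₀.le (pow_nonneg (inv_nonneg.2 hη.le) 3)) (by norm_num)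
  rw [norm_mul, hcoef]
  calc c₀ * (eta F n K)⁻¹ ^ 3 * 2⁻¹ * ‖bondPair 1 3 (Matrix.traceLinearMap (Fin 2) ℂ ℂ)
          (fun μ y => I • ad (star (Pi.single x (W x) : Site (F.P K) 0 → Matrix (Fin 2) (Fin 2) ℂ) y) (formComp Fv μ y)
            - I • ad (formComp Fv μ y) (R (bgUnits F K U₀ ⟨y, μ⟩) (star (Pi.single x (W x) : Site (F.P K) 0 → Matrix (Fin 2) (Fin 2) ℂ) (torusT (F.P K) 0 μ y))))
          (J (torusT (F.P K) 0) (fun μ x => bgUnits F K U₀ ⟨x, μ⟩) 1)‖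
      ≤ c₀ * (eta F n K)⁻¹ ^ 3 * 2⁻¹ * (4 * (α * eta F n K ^ 3) * ‖W x‖ * ∑ μ : Fin (F.P K).d, (‖Fv ⟨x, μ⟩‖ + ‖Fv ⟨(torusT (F.P K) 0 μ).symm x, μ⟩‖)) :=
        mul_le_mul_of_nonneg_left hbr hcoef0
    _ = c₀ * (2 * α * ∑ μ : Fin (F.P K).d, (‖Fv ⟨x, μ⟩‖ + ‖Fv ⟨(torusT (F.P K) 0 μ).symm x, μ⟩‖)) * ‖W x‖ * ((eta F n K)⁻¹ ^ 3 * eta F n K ^ 3) := by ring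
    _ = c₀ * (2 * α * ∑ μ : Fin (F.P K).d, (‖Fv ⟨x, μ⟩‖ + ‖Fv ⟨(torusT (F.P K) 0 μ).symm x, μ⟩‖)) * ‖W x‖ := by rw [hη3, mul_one]

/-- ★★ **(C-val) IN DECAY FORM**: if `‖λ(y)‖ ≤ m·e^{−δ·dc(B y, z)}` then `‖(toL2⁻¹(Δ^η(D(toL2S λ))))(b)‖ ≤ 2α(1 + e^{4δ})·m·e^{−δ·dc(B b₋, z)}` on `RegPr`.
[cite: Balaban1985BackgroundPropagators, (3.117) p.419, (3.131) p.422] -/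
theorem DeltaEta_DL2_decay {α δ : ℝ} (hδ : 0 ≤ δ) (U₀ : GaugeField (F.P K) 0 (Matrix.specialUnitaryGroup (Fin 2) ℂ)) (hreg : RegPr F n K α U₀)
    (lam : Site (F.P K) 0 → Matrix (Fin 2) (Fin 2) ℂ) (z : Site (F.P K) (K - n)) {m : ℝ} (hm0 : 0 ≤ m)
    (hm : ∀ y, ‖lam y‖ ≤ m * Real.exp (-(δ * (Site.tdist (iterBlockOf (K - n) y) z : ℝ)))) (b : PBond (F.P K) 0) :
    ‖(toL2 F K c₀).symm (DeltaEta F n K c₀ U₀ (DL2 F n K c₀ U₀ (toL2S F K c₀ lam))) b‖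
      ≤ 2 * α * (1 + Real.exp (4 * δ)) * m * Real.exp (-(δ * (Site.tdist (iterBlockOf (K - n) b.src) z : ℝ))) := by
  have hη : 0 < eta F n K := eta_pos F n K
  have hJ := norm_J_one_le_of_regPr U₀ hreg b.dir b.src
  have hα : 0 ≤ α := by
    have h0 : 0 * eta F n K ^ 3 ≤ α * eta F n K ^ 3 := by rw [zero_mul]; exact (norm_nonneg _).trans hJ
    exact le_of_mul_le_mul_right h0 (pow_pos hη 3)
  have h := norm_symm_DeltaEta_DL2_toL2S_apply_le (c₀ := c₀) U₀ hreg lam b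
  have h1 := hm b.src
  have h2 := (hm b.tgt).trans (mul_le_mul_of_nonneg_left (exp_neg_tdist_tgt_le (n := n) hδ b z) hm0)
  have hE : 0 ≤ Real.exp (-(δ * (Site.tdist (iterBlockOf (K - n) b.src) z : ℝ))) := (Real.exp_pos _).le
  calc ‖(toL2 F K c₀).symm (DeltaEta F n K c₀ U₀ (DL2 F n K c₀ U₀ (toL2S F K c₀ lam))) b‖
      ≤ 2 * α * (‖lam b.src‖ + ‖lam b.tgt‖) := h
    _ ≤ 2 * α * (m * Real.exp (-(δ * (Site.tdist (iterBlockOf (K - n) b.src) z : ℝ)))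
          + m * (Real.exp (4 * δ) * Real.exp (-(δ * (Site.tdist (iterBlockOf (K - n) b.src) z : ℝ))))) := by gcongr
    _ = 2 * α * (1 + Real.exp (4 * δ)) * m * Real.exp (-(δ * (Site.tdist (iterBlockOf (K - n) b.src) z : ℝ))) := by ring

/-- ★★ **(C-div) IN DECAY FORM**: if `‖F(b)‖ ≤ m·e^{−δ·dc(B b₋, z)}` then `‖(toL2S⁻¹(D*Δ^η(toL2 F)))(x)‖ ≤ 6α(1 + e^{4δ})·m·e^{−δ·dc(B x, z)}` on `RegPr` (`d = 3`).
[cite: Balaban1985BackgroundPropagators, (3.117) p.419, (3.131) p.422] -/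
theorem DstarL2_DeltaEta_decay {α δ : ℝ} (hδ : 0 ≤ δ) (U₀ : GaugeField (F.P K) 0 (Matrix.specialUnitaryGroup (Fin 2) ℂ)) (hreg : RegPr F n K α U₀)
    (Fv : PBond (F.P K) 0 → Matrix (Fin 2) (Fin 2) ℂ) (z : Site (F.P K) (K - n)) {m : ℝ} (hm0 : 0 ≤ m)
    (hm : ∀ b, ‖Fv b‖ ≤ m * Real.exp (-(δ * (Site.tdist (iterBlockOf (K - n) b.src) z : ℝ)))) (x : Site (F.P K) 0) :
    ‖(toL2S F K c₀).symm (DstarL2 F n K c₀ U₀ (DeltaEta F n K c₀ U₀ (toL2 F K c₀ Fv))) x‖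
      ≤ 6 * α * (1 + Real.exp (4 * δ)) * m * Real.exp (-(δ * (Site.tdist (iterBlockOf (K - n) x) z : ℝ))) := by
  have hη : 0 < eta F n K := eta_pos F n K
  have hJ := norm_J_one_le_of_regPr U₀ hreg 0 x
  have hα : 0 ≤ α := by
    have h0 : 0 * eta F n K ^ 3 ≤ α * eta F n K ^ 3 := by rw [zero_mul]; exact (norm_nonneg _).trans hJ
    exact le_of_mul_le_mul_right h0 (pow_pos hη 3)
  have h := norm_symm_DstarL2_DeltaEta_toL2_apply_le_local (c₀ := c₀) U₀ hreg Fv x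
  -- each of the six bonds is within coarse distance 4 of the block of `x`
  have hterm : ∀ μ : Fin (F.P K).d, ‖Fv ⟨x, μ⟩‖ + ‖Fv ⟨(torusT (F.P K) 0 μ).symm x, μ⟩‖
      ≤ (1 + Real.exp (4 * δ)) * m * Real.exp (-(δ * (Site.tdist (iterBlockOf (K - n) x) z : ℝ))) := by
    intro μ
    have h1 := hm ⟨x, μ⟩
    -- the bond `⟨x − e_μ, μ⟩` has target `x`
    set b' : PBond (F.P K) 0 := ⟨(torusT (F.P K) 0 μ).symm x, μ⟩ with hb'
    have htgt : b'.tgt = x := by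
      show ((torusT (F.P K) 0 μ).symm x).shift μ = x
      have := Equiv.apply_symm_apply (torusT (F.P K) 0 μ) x
      rwa [B9TorusCalculus.torusT_apply] at this
    have h2 := (hm b').trans (mul_le_mul_of_nonneg_left (exp_neg_tdist_src_le (n := n) hδ b' z) hm0)
    rw [htgt] at h2
    have hE : 0 ≤ Real.exp (-(δ * (Site.tdist (iterBlockOf (K - n) x) z : ℝ))) := (Real.exp_pos _).le
    calc ‖Fv ⟨x, μ⟩‖ + ‖Fv b'‖ ≤ m * Real.exp (-(δ * (Site.tdist (iterBlockOf (K - n) x) z : ℝ)))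
          + m * (Real.exp (4 * δ) * Real.exp (-(δ * (Site.tdist (iterBlockOf (K - n) x) z : ℝ)))) := add_le_add h1 h2
      _ = (1 + Real.exp (4 * δ)) * m * Real.exp (-(δ * (Site.tdist (iterBlockOf (K - n) x) z : ℝ))) := by ring
  have hd : (Finset.univ : Finset (Fin (F.P K).d)).card = 3 := by rw [Finset.card_univ, Fintype.card_fin]; rfl
  have hsum : ∑ μ : Fin (F.P K).d, (‖Fv ⟨x, μ⟩‖ + ‖Fv ⟨(torusT (F.P K) 0 μ).symm x, μ⟩‖)
      ≤ 3 * ((1 + Real.exp (4 * δ)) * m * Real.exp (-(δ * (Site.tdist (iterBlockOf (K - n) x) z : ℝ)))) := by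
    calc ∑ μ : Fin (F.P K).d, (‖Fv ⟨x, μ⟩‖ + ‖Fv ⟨(torusT (F.P K) 0 μ).symm x, μ⟩‖)
        ≤ ∑ _μ : Fin (F.P K).d, (1 + Real.exp (4 * δ)) * m * Real.exp (-(δ * (Site.tdist (iterBlockOf (K - n) x) z : ℝ))) := Finset.sum_le_sum fun μ _ => hterm μ
      _ = 3 * ((1 + Real.exp (4 * δ)) * m * Real.exp (-(δ * (Site.tdist (iterBlockOf (K - n) x) z : ℝ)))) := by
          rw [Finset.sum_const, hd, nsmul_eq_mul, Nat.cast_ofNat]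
  calc ‖(toL2S F K c₀).symm (DstarL2 F n K c₀ U₀ (DeltaEta F n K c₀ U₀ (toL2 F K c₀ Fv))) x‖
      ≤ 2 * α * ∑ μ : Fin (F.P K).d, (‖Fv ⟨x, μ⟩‖ + ‖Fv ⟨(torusT (F.P K) 0 μ).symm x, μ⟩‖) := h
    _ ≤ 2 * α * (3 * ((1 + Real.exp (4 * δ)) * m * Real.exp (-(δ * (Site.tdist (iterBlockOf (K - n) x) z : ℝ))))) :=
        mul_le_mul_of_nonneg_left hsum (by positivity)
    _ = 6 * α * (1 + Real.exp (4 * δ)) * m * Real.exp (-(δ * (Site.tdist (iterBlockOf (K - n) x) z : ℝ))) := by ring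

end Local

end Summit.QuantumFields.YangMills.Theorems.Prop7GreenPiBlockDecayLocal

end
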